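import Literature.NumberTheory.LFunctions.Zhang2022.ObjectiveTwinDetAfeK13
import Literature.NumberTheory.LFunctions.Zhang2022.EllRegimeK0Plane

/-!
# Zhang (2022) design-space objective, twin part 17: PSD OF ANY RECIPE ON THE ONE-SIDED `K₀` PLANE — a decidable
# criterion in the six channel moments, and a kernel plateau point of the §D «vernier» scan

Y. Zhang, *Discrete mean estimates and the Landau–Siegel zero*, arXiv:2211.02515v1 (2022)
[Zhang2022LandauSiegel] — an unrefereed manuscript under adjudication. **This file SEARCHES and TYPES; it
makes no claim about Landau–Siegel zeros, about Theorems 1–2 of the manuscript, or about a repaired (2.32),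
until a kernel theorem says so.** LANDAU–SIEGEL programme, cell `landau-siegel`, §A Lean twin serving §D (edge ell).

Part 16 (`ObjectiveTwinDetAfeK13`) wrote formula I of an ARBITRARY recipe `R` on the one-sided plane
`u = a(k₁+k₂) + b(k₂+k₃)` (all of `span{k₁,k₂,k₃} ∩ {u(1) = 0}`) as `α‖a‖² + δ‖b‖² + γ·Re(ab̄) + γ′·Im(ab̄)` with
`α, δ, γ, γ′` explicit real-linear forms in the six channel moments (`Det.formDet_recipe_plane`). With
ls-Bell-typer-2's `2×2` Hermitian lemma `EllRegime.herm2_forall_nonneg_iff_psd` this gives: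

* `Det.formDet_recipe_plane_herm2` — the same form as `α·|a|² + δ·|b|² + 2Re(z·ā·b)`, `z = (γ + iγ′)/2`;
* **`Det.formDet_recipe_plane_nonneg_iff`** — `(∀ a b, 0 ≤ FormDet R (a(k₁+k₂)+b(k₂+k₃))) ↔ 0 ≤ α ∧ 0 ≤ δ ∧
  (γ² + γ′²)/4 ≤ α·δ`: PSD of ANY detector recipe on the one-sided part of the AFE span is DECIDED by three
  inequalities in the moments (exact arithmetic for recipes with algebraic phases);
* a PLATEAU point of ls-ref-1's vernier scan (cell STATUS 2026-08-27T00:34:41Z (i): admissible near shift `b₀ < 1`,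
  far pair `(J+m−θ, J+1−m−θ)`, here `b₀ = ½`, `J = 3`, `θ = ½`, `m = ¼`): `Det.shiftW_plateau` (`W(½, 11/4, 13/4) =
  ((4√2/99)(−1+i), −22i/9, 26/11)`), `Det.moments_plateau`, and **`Det.formDet_shiftRecipe_plateau_plane_nonneg`**:
  `FormDet (shiftRecipe (½, 11/4, 13/4)) ≥ 0` on the WHOLE plane (`α ≈ 62.22`, `δ ≈ 13.47`, `4αδ − γ² − γ′² ≈ 2343 > 0`;
  exact values in `ℚ(√2) + ℚ(√2)·π`) — versus part 16's EDGE point `(1, 11/4, 13/4)` (same far pair, `b₀ = 1`) where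
  `k₁ − k₃` is negative. SCOPE: the plane is the 2-dimensional core of the numerics' 14–45-dimensional exponential
  spans; PSD here is necessary, not sufficient, for their plateau statement; a negative plane direction would have
  been decisive, a PSD one is a kernel floor. Theorems only; no new definitions.
-/

noncomputable section

open Complex Real ComplexConjugate

namespace Literature.NumberTheory.LFunctions.Zhang2022

namespace Det

open Repair Objective EllRegime

/-! ## The plane form in `2×2` Hermitian shape and the PSD criterion -/

/-- Bridge to the Hermitian shape: `γ·Re(ab̄) + γ′·Im(ab̄) = 2·Re(z·ā·b)` with `z = (γ + iγ′)/2`, and `‖a‖² = |a|²`.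
[folklore] -/
private theorem plane_cross_eq (γ γ' : ℝ) (a b : ℂ) :
    γ * (a * conj b).re + γ' * (a * conj b).im =
      2 * ((((γ : ℂ) + (γ' : ℂ) * I) / 2) * conj a * b).re := by
  simp only [Complex.mul_re, Complex.mul_im, Complex.add_re, Complex.add_im, Complex.div_ofNat_re,
    Complex.div_ofNat_im, Complex.ofReal_re, Complex.ofReal_im, Complex.I_re, Complex.I_im, Complex.conj_re,
    Complex.conj_im]
  ring

/-- `|z|²` for `z = (γ + iγ′)/2` is `(γ² + γ′²)/4`. [folklore] -/
private theorem normSq_half (γ γ' : ℝ) :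
    Complex.normSq ((((γ : ℂ) + (γ' : ℂ) * I) / 2)) = (γ ^ 2 + γ' ^ 2) / 4 := by
  rw [Complex.normSq_apply]
  simp only [Complex.add_re, Complex.add_im, Complex.div_ofNat_re, Complex.div_ofNat_im, Complex.ofReal_re,
    Complex.ofReal_im, Complex.mul_re, Complex.mul_im, Complex.I_re, Complex.I_im]
  ring

/-- **Formula I of any recipe on the plane, Hermitian shape**: `α·|a|² + δ·|b|² + 2Re(z·ā·b)` with the part-16
coefficients and `z = (γ + iγ′)/2`. [cite: Zhang2022LandauSiegel, Prop 7.1 p.44 with (8.11)–(8.23); §2 (2.13)] -/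
theorem formDet_recipe_plane_herm2 (R : DetRecipe) (a b : ℂ) :
    FormDet R (fun y => a * afeDir 1 y + (a + b) * afeDir 2 y + b * afeDir 3 y)
        (fun y => a * afeDir' 1 y + (a + b) * afeDir' 2 y + b * afeDir' 3 y) =
      (10 * π * (∑ j : Fin 3, R.W j).re
          - 6 * π * (∑ j : Fin 3, R.W j * (R.s j : ℂ)).re - 4 * (∑ j : Fin 3, R.W j * (R.s j : ℂ)).im
          - 6 * π * (∑ j : Fin 3, R.W j * (R.b j : ℂ)).re + 4 * (∑ j : Fin 3, R.W j * (R.b j : ℂ)).im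
          + 4 * π * (∑ j : Fin 3, R.W j * (R.n j : ℂ)).re + 8 * (∑ j : Fin 3, R.W j * (R.n j : ℂ)).im
          + 4 * π * (∑ j : Fin 3, R.W j * ((R.b j : ℂ) * (R.s j : ℂ))).re
          - 3 * π * (∑ j : Fin 3, R.W j * ((R.b j : ℂ) * (R.n j : ℂ))).re
          - 4 * (∑ j : Fin 3, R.W j * ((R.b j : ℂ) * (R.n j : ℂ))).im) * Complex.normSq a
      + (26 * π * (∑ j : Fin 3, R.W j).re
          - 10 * π * (∑ j : Fin 3, R.W j * (R.s j : ℂ)).re - 4 * (∑ j : Fin 3, R.W j * (R.s j : ℂ)).im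
          - 10 * π * (∑ j : Fin 3, R.W j * (R.b j : ℂ)).re + 4 * (∑ j : Fin 3, R.W j * (R.b j : ℂ)).im
          + 4 * π * (∑ j : Fin 3, R.W j * (R.n j : ℂ)).re + 8 / 3 * (∑ j : Fin 3, R.W j * (R.n j : ℂ)).im
          + 4 * π * (∑ j : Fin 3, R.W j * ((R.b j : ℂ) * (R.s j : ℂ))).re
          - 5 * π / 3 * (∑ j : Fin 3, R.W j * ((R.b j : ℂ) * (R.n j : ℂ))).re
          - 4 / 9 * (∑ j : Fin 3, R.W j * ((R.b j : ℂ) * (R.n j : ℂ))).im) * Complex.normSq b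
      + 2 * (((((16 * π * (∑ j : Fin 3, R.W j).re
          - 8 * π * (∑ j : Fin 3, R.W j * (R.s j : ℂ)).re - 8 * (∑ j : Fin 3, R.W j * (R.s j : ℂ)).im
          - 8 * π * (∑ j : Fin 3, R.W j * (R.b j : ℂ)).re + 8 * (∑ j : Fin 3, R.W j * (R.b j : ℂ)).im
          + 4 * π * (∑ j : Fin 3, R.W j * (R.n j : ℂ)).re + 32 / 3 * (∑ j : Fin 3, R.W j * (R.n j : ℂ)).im
          + 4 * π * (∑ j : Fin 3, R.W j * ((R.b j : ℂ) * (R.s j : ℂ))).re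
          - 2 * π * (∑ j : Fin 3, R.W j * ((R.b j : ℂ) * (R.n j : ℂ))).re
          - 8 / 3 * (∑ j : Fin 3, R.W j * ((R.b j : ℂ) * (R.n j : ℂ))).im : ℝ) : ℂ)
        + ((-64 * (∑ j : Fin 3, R.W j).re
          + 32 * (∑ j : Fin 3, R.W j * (R.s j : ℂ)).re + 32 * (∑ j : Fin 3, R.W j * (R.b j : ℂ)).re
          - 64 / 3 * (∑ j : Fin 3, R.W j * (R.n j : ℂ)).re
          - 16 * (∑ j : Fin 3, R.W j * ((R.b j : ℂ) * (R.s j : ℂ))).re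
          + 32 / 3 * (∑ j : Fin 3, R.W j * ((R.b j : ℂ) * (R.n j : ℂ))).re : ℝ) : ℂ) * I) / 2)
          * conj a * b).re := by
  rw [formDet_recipe_plane, Complex.sq_norm, Complex.sq_norm, ← plane_cross_eq]
  ring

/-- **PSD CRITERION for any recipe on the one-sided plane `a(k₁+k₂) + b(k₂+k₃)`**:
`(∀ a b, 0 ≤ FormDet R (…)) ↔ 0 ≤ α ∧ 0 ≤ δ ∧ (γ² + γ′²)/4 ≤ α·δ` (part 16's `α, δ, γ, γ′`).
[cite: Zhang2022LandauSiegel, Prop 7.1 p.44 with (8.11)–(8.23); §2 (2.13), Lemma 2.3] -/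
theorem formDet_recipe_plane_nonneg_iff (R : DetRecipe) :
    (∀ a b : ℂ, 0 ≤ FormDet R (fun y => a * afeDir 1 y + (a + b) * afeDir 2 y + b * afeDir 3 y)
        (fun y => a * afeDir' 1 y + (a + b) * afeDir' 2 y + b * afeDir' 3 y)) ↔
      (0 ≤ 10 * π * (∑ j : Fin 3, R.W j).re
          - 6 * π * (∑ j : Fin 3, R.W j * (R.s j : ℂ)).re - 4 * (∑ j : Fin 3, R.W j * (R.s j : ℂ)).im
          - 6 * π * (∑ j : Fin 3, R.W j * (R.b j : ℂ)).re + 4 * (∑ j : Fin 3, R.W j * (R.b j : ℂ)).im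
          + 4 * π * (∑ j : Fin 3, R.W j * (R.n j : ℂ)).re + 8 * (∑ j : Fin 3, R.W j * (R.n j : ℂ)).im
          + 4 * π * (∑ j : Fin 3, R.W j * ((R.b j : ℂ) * (R.s j : ℂ))).re
          - 3 * π * (∑ j : Fin 3, R.W j * ((R.b j : ℂ) * (R.n j : ℂ))).re
          - 4 * (∑ j : Fin 3, R.W j * ((R.b j : ℂ) * (R.n j : ℂ))).im ∧
       0 ≤ 26 * π * (∑ j : Fin 3, R.W j).re
          - 10 * π * (∑ j : Fin 3, R.W j * (R.s j : ℂ)).re - 4 * (∑ j : Fin 3, R.W j * (R.s j : ℂ)).im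
          - 10 * π * (∑ j : Fin 3, R.W j * (R.b j : ℂ)).re + 4 * (∑ j : Fin 3, R.W j * (R.b j : ℂ)).im
          + 4 * π * (∑ j : Fin 3, R.W j * (R.n j : ℂ)).re + 8 / 3 * (∑ j : Fin 3, R.W j * (R.n j : ℂ)).im
          + 4 * π * (∑ j : Fin 3, R.W j * ((R.b j : ℂ) * (R.s j : ℂ))).re
          - 5 * π / 3 * (∑ j : Fin 3, R.W j * ((R.b j : ℂ) * (R.n j : ℂ))).re
          - 4 / 9 * (∑ j : Fin 3, R.W j * ((R.b j : ℂ) * (R.n j : ℂ))).im ∧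
       ((16 * π * (∑ j : Fin 3, R.W j).re
          - 8 * π * (∑ j : Fin 3, R.W j * (R.s j : ℂ)).re - 8 * (∑ j : Fin 3, R.W j * (R.s j : ℂ)).im
          - 8 * π * (∑ j : Fin 3, R.W j * (R.b j : ℂ)).re + 8 * (∑ j : Fin 3, R.W j * (R.b j : ℂ)).im
          + 4 * π * (∑ j : Fin 3, R.W j * (R.n j : ℂ)).re + 32 / 3 * (∑ j : Fin 3, R.W j * (R.n j : ℂ)).im
          + 4 * π * (∑ j : Fin 3, R.W j * ((R.b j : ℂ) * (R.s j : ℂ))).re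
          - 2 * π * (∑ j : Fin 3, R.W j * ((R.b j : ℂ) * (R.n j : ℂ))).re
          - 8 / 3 * (∑ j : Fin 3, R.W j * ((R.b j : ℂ) * (R.n j : ℂ))).im) ^ 2
        + (-64 * (∑ j : Fin 3, R.W j).re
          + 32 * (∑ j : Fin 3, R.W j * (R.s j : ℂ)).re + 32 * (∑ j : Fin 3, R.W j * (R.b j : ℂ)).re
          - 64 / 3 * (∑ j : Fin 3, R.W j * (R.n j : ℂ)).re
          - 16 * (∑ j : Fin 3, R.W j * ((R.b j : ℂ) * (R.s j : ℂ))).re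
          + 32 / 3 * (∑ j : Fin 3, R.W j * ((R.b j : ℂ) * (R.n j : ℂ))).re) ^ 2) / 4 ≤
       (10 * π * (∑ j : Fin 3, R.W j).re
          - 6 * π * (∑ j : Fin 3, R.W j * (R.s j : ℂ)).re - 4 * (∑ j : Fin 3, R.W j * (R.s j : ℂ)).im
          - 6 * π * (∑ j : Fin 3, R.W j * (R.b j : ℂ)).re + 4 * (∑ j : Fin 3, R.W j * (R.b j : ℂ)).im
          + 4 * π * (∑ j : Fin 3, R.W j * (R.n j : ℂ)).re + 8 * (∑ j : Fin 3, R.W j * (R.n j : ℂ)).im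
          + 4 * π * (∑ j : Fin 3, R.W j * ((R.b j : ℂ) * (R.s j : ℂ))).re
          - 3 * π * (∑ j : Fin 3, R.W j * ((R.b j : ℂ) * (R.n j : ℂ))).re
          - 4 * (∑ j : Fin 3, R.W j * ((R.b j : ℂ) * (R.n j : ℂ))).im) *
       (26 * π * (∑ j : Fin 3, R.W j).re
          - 10 * π * (∑ j : Fin 3, R.W j * (R.s j : ℂ)).re - 4 * (∑ j : Fin 3, R.W j * (R.s j : ℂ)).im
          - 10 * π * (∑ j : Fin 3, R.W j * (R.b j : ℂ)).re + 4 * (∑ j : Fin 3, R.W j * (R.b j : ℂ)).im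
          + 4 * π * (∑ j : Fin 3, R.W j * (R.n j : ℂ)).re + 8 / 3 * (∑ j : Fin 3, R.W j * (R.n j : ℂ)).im
          + 4 * π * (∑ j : Fin 3, R.W j * ((R.b j : ℂ) * (R.s j : ℂ))).re
          - 5 * π / 3 * (∑ j : Fin 3, R.W j * ((R.b j : ℂ) * (R.n j : ℂ))).re
          - 4 / 9 * (∑ j : Fin 3, R.W j * ((R.b j : ℂ) * (R.n j : ℂ))).im)) := by
  simp_rw [formDet_recipe_plane_herm2]
  rw [herm2_forall_nonneg_iff_psd, normSq_half]

/-! ## A plateau point of the §D vernier scan: `b = (1/2, 11/4, 13/4)` -/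

/-- `cos(3π/4) = −√2/2`. [folklore] -/
private theorem cos_three_pi_div_four' : Real.cos (3 * π / 4) = -(Real.sqrt 2 / 2) := by
  rw [show 3 * π / 4 = π - π / 4 by ring, Real.cos_pi_sub, Real.cos_pi_div_four]

/-- `sin(3π/4) = √2/2`. [folklore] -/
private theorem sin_three_pi_div_four' : Real.sin (3 * π / 4) = Real.sqrt 2 / 2 := by
  rw [show 3 * π / 4 = π - π / 4 by ring, Real.sin_pi_sub, Real.sin_pi_div_four]

/-- `s(1/2, 11/4, 13/4) = (6, 15/4, 13/4)`. [cite: Zhang2022LandauSiegel, §8 (8.13)–(8.18)] -/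
theorem shiftS_plateau : shiftS ![1 / 2, 11 / 4, 13 / 4] = ![6, 15 / 4, 13 / 4] := by
  funext j; fin_cases j <;> (simp [shiftS]; try norm_num)

/-- `n(1/2, 11/4, 13/4) = (143/16, 13/8, 11/8)`. [cite: Zhang2022LandauSiegel, §8 (8.13)–(8.18)] -/
theorem shiftN_plateau : shiftN ![1 / 2, 11 / 4, 13 / 4] = ![143 / 16, 13 / 8, 11 / 8] := by
  funext j; fin_cases j <;> (simp [shiftN]; try norm_num)

/-- **`W(1/2, 11/4, 13/4) = ((4√2/99)(−1 + i), −22i/9, 26/11)`** (phases `e^{11πi/4} = e^{3πi/4}`, `e^{πi/2} = i`,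
`e⁰ = 1`; denominators `v = (99/16, −9/8, 11/8)`). [cite: Zhang2022LandauSiegel, proof of Prop 7.1, (7.19)–(7.21)] -/
theorem shiftW_plateau : shiftW ![1 / 2, 11 / 4, 13 / 4] =
    ![((4 * Real.sqrt 2 / 99 : ℝ) : ℂ) * (-1 + I), -(22 / 9 : ℂ) * I, 26 / 11] := by
  funext j
  fin_cases j
  · simp only [shiftW, shiftS, shiftVdm]
    simp only [Fin.zero_eta, Fin.isValue, Matrix.cons_val_zero, Matrix.cons_val_one, Matrix.head_cons,
      Matrix.cons_val_two, Matrix.tail_cons]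
    have h : cexp (I * π * (((11 / 4 + 13 / 4 - 1 / 2) / 2 : ℝ) : ℂ)) =
        ((-(Real.sqrt 2 / 2) : ℝ) : ℂ) + ((Real.sqrt 2 / 2 : ℝ) : ℂ) * I := by
      rw [show (((11 / 4 + 13 / 4 - 1 / 2) / 2 : ℝ) : ℂ) = ((3 * π / 4 : ℝ) : ℂ) / π + 2 by
            push_cast; field_simp [Complex.ofReal_ne_zero.mpr Real.pi_ne_zero]; ring,
        show I * π * (((3 * π / 4 : ℝ) : ℂ) / π + 2) = ((3 * π / 4 : ℝ) : ℂ) * I + 2 * π * I by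
            field_simp [Complex.ofReal_ne_zero.mpr Real.pi_ne_zero],
        Complex.exp_add, Complex.exp_two_pi_mul_I, mul_one,
        Complex.exp_mul_I, ← Complex.ofReal_cos, ← Complex.ofReal_sin, cos_three_pi_div_four', sin_three_pi_div_four']
    rw [h]; push_cast; field_simp; ring
  · simp only [shiftW, shiftS, shiftVdm]
    simp only [Fin.mk_one, Fin.isValue, Matrix.cons_val_zero, Matrix.cons_val_one, Matrix.head_cons,
      Matrix.cons_val_two, Matrix.tail_cons]
    have h : cexp (I * π * (((13 / 4 + 1 / 2 - 11 / 4) / 2 : ℝ) : ℂ)) = I := by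
      rw [show (((13 / 4 + 1 / 2 - 11 / 4) / 2 : ℝ) : ℂ) = 1 / 2 by push_cast; norm_num,
        show I * π * (1 / 2) = (π / 2 : ℂ) * I by ring, Complex.exp_mul_I, Complex.cos_pi_div_two,
        Complex.sin_pi_div_two]
      simp
    rw [h]; push_cast; field_simp; ring_nf
  · simp only [shiftW, shiftS, shiftVdm]
    simp only [Fin.reduceFinMk, Fin.isValue, Matrix.cons_val_zero, Matrix.cons_val_one, Matrix.head_cons,
      Matrix.cons_val_two, Matrix.tail_cons]
    have h : cexp (I * π * (((1 / 2 + 11 / 4 - 13 / 4) / 2 : ℝ) : ℂ)) = 1 := by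
      rw [show (((1 / 2 + 11 / 4 - 13 / 4) / 2 : ℝ) : ℂ) = 0 by push_cast; norm_num, mul_zero, Complex.exp_zero]
    rw [h]; push_cast; norm_num

/-- The six channel moments of `shiftRecipe (1/2, 11/4, 13/4)` (exact, in `ℚ(√2, i)`):
`m₀ = 26/11 − (4√2/99) + i(−22/9 + 4√2/99)`, `m_s = 169/22 − 8√2/33 + i(−55/6 + 8√2/33)`,
`m_n = 13/4 − 13√2/36 + i(−143/36 + 13√2/36)`, `m_b = 169/22 − 2√2/99 + i(−121/18 + 2√2/99)`,
`m_bs = 2197/88 − 4√2/33 + i(−605/24 + 4√2/33)`, `m_bn = 169/16 − 13√2/72 + i(−1573/144 + 13√2/72)`.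
[cite: Zhang2022LandauSiegel, Prop 7.1 p.44, (8.11)–(8.23)] -/
theorem moments_plateau :
    (∑ j : Fin 3, (shiftRecipe ![1 / 2, 11 / 4, 13 / 4]).W j) =
        ((26 / 11 - 4 * Real.sqrt 2 / 99 : ℝ) : ℂ) + ((-(22 / 9) + 4 * Real.sqrt 2 / 99 : ℝ) : ℂ) * I ∧
    (∑ j : Fin 3, (shiftRecipe ![1 / 2, 11 / 4, 13 / 4]).W j * ((shiftRecipe ![1 / 2, 11 / 4, 13 / 4]).s j : ℂ)) =
        ((169 / 22 - 8 * Real.sqrt 2 / 33 : ℝ) : ℂ) + ((-(55 / 6) + 8 * Real.sqrt 2 / 33 : ℝ) : ℂ) * I ∧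
    (∑ j : Fin 3, (shiftRecipe ![1 / 2, 11 / 4, 13 / 4]).W j * ((shiftRecipe ![1 / 2, 11 / 4, 13 / 4]).n j : ℂ)) =
        ((13 / 4 - 13 * Real.sqrt 2 / 36 : ℝ) : ℂ) + ((-(143 / 36) + 13 * Real.sqrt 2 / 36 : ℝ) : ℂ) * I ∧
    (∑ j : Fin 3, (shiftRecipe ![1 / 2, 11 / 4, 13 / 4]).W j * ((shiftRecipe ![1 / 2, 11 / 4, 13 / 4]).b j : ℂ)) =
        ((169 / 22 - 2 * Real.sqrt 2 / 99 : ℝ) : ℂ) + ((-(121 / 18) + 2 * Real.sqrt 2 / 99 : ℝ) : ℂ) * I ∧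
    (∑ j : Fin 3, (shiftRecipe ![1 / 2, 11 / 4, 13 / 4]).W j *
        (((shiftRecipe ![1 / 2, 11 / 4, 13 / 4]).b j : ℂ) * ((shiftRecipe ![1 / 2, 11 / 4, 13 / 4]).s j : ℂ))) =
        ((2197 / 88 - 4 * Real.sqrt 2 / 33 : ℝ) : ℂ) + ((-(605 / 24) + 4 * Real.sqrt 2 / 33 : ℝ) : ℂ) * I ∧
    (∑ j : Fin 3, (shiftRecipe ![1 / 2, 11 / 4, 13 / 4]).W j *
        (((shiftRecipe ![1 / 2, 11 / 4, 13 / 4]).b j : ℂ) * ((shiftRecipe ![1 / 2, 11 / 4, 13 / 4]).n j : ℂ))) =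
        ((169 / 16 - 13 * Real.sqrt 2 / 72 : ℝ) : ℂ) + ((-(1573 / 144) + 13 * Real.sqrt 2 / 72 : ℝ) : ℂ) * I := by
  simp only [shiftRecipe, shiftW_plateau, shiftS_plateau, shiftN_plateau, Fin.sum_univ_three]
  simp only [Fin.isValue, Matrix.cons_val_zero, Matrix.cons_val_one, Matrix.head_cons, Matrix.cons_val_two,
    Matrix.tail_cons]
  push_cast
  refine ⟨?_, ?_, ?_, ?_, ?_, ?_⟩ <;> ring_nf

/-- **A PLATEAU POINT IS PSD ON THE PLANE**: for the admissible-side recipe `b = (1/2, 11/4, 13/4)` (near shift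
`b₀ = ½ < 1`, far pair `(11/4, 13/4)` straddling `3`, `m = ¼`), `FormDet (shiftRecipe b) ≥ 0` on the whole one-sided
plane `a(k₁+k₂) + b(k₂+k₃)` (`α = (2223/176 − 19√2/88)π + 781/36 + 23√2/18 ≈ 62.22`, `δ ≈ 13.47`, `γ ≈ 28.95`,
`γ′ = −520/33 + 188√2/99 ≈ −13.07`; `4αδ − γ² − γ′² ≈ 2343`). Compare part 16: the same far pair with `b₀ = 1` is
negative on `k₁ − k₃`. [cite: Zhang2022LandauSiegel, Prop 7.1 p.44 with (8.11)–(8.23); §2 (2.13), Lemma 2.3] -/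
theorem formDet_shiftRecipe_plateau_plane_nonneg (a b : ℂ) :
    0 ≤ FormDet (shiftRecipe ![1 / 2, 11 / 4, 13 / 4]) (fun y => a * afeDir 1 y + (a + b) * afeDir 2 y + b * afeDir 3 y)
        (fun y => a * afeDir' 1 y + (a + b) * afeDir' 2 y + b * afeDir' 3 y) := by
  revert a b
  rw [formDet_recipe_plane_nonneg_iff]
  obtain ⟨h0, hs, hn, hb, hbs, hbn⟩ := moments_plateau
  rw [h0, hs, hn, hb, hbs, hbn]
  simp only [Complex.add_re, Complex.add_im, Complex.mul_re, Complex.mul_im, Complex.I_re, Complex.I_im,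
    Complex.ofReal_re, Complex.ofReal_im, mul_zero, mul_one, sub_zero, add_zero, zero_add]
  have h1 := Real.pi_gt_d6
  have h2 := Real.pi_lt_d6
  have hs0 : (0:ℝ) ≤ Real.sqrt 2 := Real.sqrt_nonneg _
  have hsq : Real.sqrt 2 ^ 2 = 2 := Real.sq_sqrt (by norm_num)
  have hs1 : (1.41421356 : ℝ) < Real.sqrt 2 := by nlinarith
  have hs2 : Real.sqrt 2 < (1.41421357 : ℝ) := by nlinarith
  refine ⟨?_, ?_, ?_⟩
  · nlinarith
  · nlinarith
  · nlinarith [mul_pos (by linarith : (0:ℝ) < π - 3.14159) (by linarith : (0:ℝ) < Real.sqrt 2 - 1.414),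
      sq_nonneg (π - 3.1416), sq_nonneg (Real.sqrt 2 - 1.41421)]

end Det

end Literature.NumberTheory.LFunctions.Zhang2022
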